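import Summits.QuantumFields.YangMills.Theorems.UnitScaleTiltProp7LemmaHCurvedFramesOfReg335
import Summits.QuantumFields.YangMills.Theorems.UnitScaleTiltProp7LemmaHCurvedCubeCover
import Summits.QuantumFields.YangMills.Theorems.UnitScaleTiltProp7SectET3ClassTransfer
import HarnessLib

/-!
# Route `UnitScaleTilt`, crux K1 «MinimiserStabilityRegPr» (stmt-QuantumFields-19200), route-R E′ path (α′), LEMMA-H-curved (design (x2′-corner)), file F-H7b(ii) —
# THE FRAMES OF ✓ `lemmaH_curved_of_rows` AT THE MEMBER OF RECORD, UNCONDITIONALLY: `RegPr F n K α₀ W` with `M·α₀ ≤ a₅` ⟹ `(hFr)(hFr1)(hA)`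

Cell `ym3-torus`, extra width seat `ym-routeR-w4` (g9); row «routeR-w4: F-H7» (★routeR-w1 g5, 2026-08-28 19:44Z).  THEOREMS ONLY (0 `def`, 0 `sorry`); `--supports
stmt-QuantumFields-19200`, count-neutral.  THE CHAIN, ALL BY NAME: ✓`Prop7SectET3ClassTransfer.reg335_reg336_T3_of_regPr` (ym-inputs-p06: [Balaban1985RegularSpaces]
(1.33) second clause = Prop. 6 at the member of record `Prop7SectET3Members.memberIdx`, consumed from the N05 lineage) ⟹ (3.35) of the V1 reading `cfgV1OfT3 W` on the
member's cube class `cubeClass396` ⟹ (✓`reg335_bgT3_iff`) r06's `Reg335Cube` on every class cube ⟹ [this seat's ✓`Prop7LemmaHCurvedCubeCover.exists_gridCube_cover` at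
`B := bigSide ℓ L^{a′} (K−n)`: the support set of each centre with its `±e_μ` neighbours sits in an index-`(K−n)` class cube `torusCube c (2B)`, `n′ = 2`] ⟹ ✓p662710
`exists_frames_of_reg335_T3`.  YM₃ on T³ is a ladder rung (R3), not the Clay problem; nothing here claims LEMMA-H-curved, a stub, the crux or the gap.

WHAT IS PROVED (ns `…Theorems.Prop7LemmaHCurvedFramesOfRegPr`).
* §1 member bookkeeping: `bigSide_ge` (`4·L^{K−n} + 1 ≤ bigSide ℓ L^{a′} (K−n)`), `bigSide_dvd_sitesPerDir`, `gridCube_mem_cubeClass396` (an aligned cube of side `2·bigSide` is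
  a class cube of index `K − n` at the member — ✓`levV1_memberIdx`, ✓`two_mul_side_add_two_le`), `scaleLen_eta_memberIdx` (`ξ = L^{K−n}·L^{−(K−n)} = 1`).
* §2 ★★★ `exists_frames_T3_of_regPr` — for odd `L = ℓ + 1 ≥ 5`: `∃ c35 a₅ > 0, ∀ member (hℓ m hm n K a′ R …), ∀ α₀ > 0, (L·L^{a′})·α₀ ≤ a₅ → ∀ W : SU(2) field,
  RegPr ⟨ℓ+1, hL, m, hm⟩ n K α₀ W → ∃ Fr, (hFr) ∧ (hFr1) ∧ (hA)` with `a₀ = η·C′·e^{η·C′}`, `a₁ = η·(η·C′)·e^{η·C′}`, `η = (L^{K−n})⁻¹`, `C′ = c35·(L·L^{a′})·α₀` — the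
  `(hFr)(hFr1)(hA)` hypotheses of ✓p661714 `lemmaH_curved_of_rows` VERBATIM (`F := ⟨ℓ+1, hL, m, hm⟩`, `F.P K = PV 2 ℓ m K` by `rfl`), k-UNIFORM (`a₀ ≍ α₀∕ℓ`, `a₁ ≍ α₀∕ℓ²`).
HONEST SCOPE.  Bookkeeping; the analytic input is [B8] Prop. 6 as consumed by ✓`reg335_reg336_T3_of_regPr`; the smallness `M·α₀ ≤ a₅` is print's («for α₀ sufficiently small»,
[Balaban1985RegularSpaces] p.99) and is the ONLY condition beyond `RegPr`.

References: T. Bałaban, CMP 99 (1985) 75–102 [Balaban1985RegularSpaces] ((1.33) p.82, Prop. 6 p.99); CMP 99 (1985) 389–434 [Balaban1985BackgroundPropagators] ((3.35) p.396);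
CMP 102 (1985) 277–309 [Balaban1985Variational] ((2), (6) p.278, Sect. A p.280).
-/

set_option autoImplicit false

noncomputable section

open scoped Matrix.Norms.L2Operator

namespace Summit.QuantumFields.YangMills.Theorems.Prop7LemmaHCurvedFramesOfRegPr

open Literature.MathematicalPhysics.QuantumFieldTheory.Balaban1983to89
open Literature.MathematicalPhysics.QuantumFieldTheory.Balaban1983to89.T3ContinuumYM3Torus
open Literature.MathematicalPhysics.QuantumFieldTheory.Balaban1983to89.T3PrintedRegularMinimiser (RegPr)
open Literature.MathematicalPhysics.QuantumFieldTheory.Balaban1983to89.B6KLevelCensusIndexV1 (KIdx kGeo)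
open Literature.MathematicalPhysics.QuantumFieldTheory.Balaban1983to89.B6GlobalChartV1 (PV)
open Literature.MathematicalPhysics.QuantumFieldTheory.Balaban1983to89.B9BackgroundsKLevelV1 (torusCube mem_torusCube_self levV1 levV1_le IsCube396 cubeClass396
  shiftsV1 eta_pos_L_one_le_M_pos)
open B6MultiLevelBoxOperator (bigSide)
open B9TorusCalculus (torusT)
open B10Eq27TorusAxialLog (unitsField toUField)
open B5Eq118OneStroke (iterBlockOf)
open B15DeterminingSets (embIter)
open B9Eq335RegularityClasses (Reg335Cube)
open LatticeNorms (scaleLen)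
open Summit.QuantumFields.YangMills.Theorems.Prop7SectET3Members (hd3 memberIdx hkw)
open Summit.QuantumFields.YangMills.Theorems.Prop7SectET3BgClass (bgT3 cfgV1OfT3 reg335_bgT3_iff eta_memberIdx M_memberIdx)
open Summit.QuantumFields.YangMills.Theorems.Prop7SectET3ClassTransfer (levV1_memberIdx sitesPerDir_memberIdx two_mul_side_add_two_le reg335_reg336_T3_of_regPr)
open Summit.QuantumFields.YangMills.Theorems.Prop7LemmaHCurvedCubeCover (exists_gridCube_cover)
open Summit.QuantumFields.YangMills.Theorems.Prop7LemmaHCurvedFramesOfReg335 (exists_frames_of_reg335_T3)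

variable {ℓ : ℕ} {hL : Odd (ℓ + 1) ∧ 1 < ℓ + 1}

/-! ## §1 Member bookkeeping -/

/-- `4·L^{K−n} + 1 ≤ bigSide = L^{a′}·L^{K−n}·L` (`L^{a′} ≥ 8`, `L ≥ 5`). [cite: Balaban1985BackgroundPropagators, p.396 (bookkeeping)] -/
theorem bigSide_ge (hℓ : 4 ≤ ℓ) {K n a' : ℕ} (hM8 : 8 ≤ (ℓ + 1) ^ a') :
    4 * (ℓ + 1) ^ (K - n) + 1 ≤ bigSide ℓ ((ℓ + 1) ^ a') (K - n) := by
  unfold bigSide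
  have hx : 1 ≤ (ℓ + 1) ^ (K - n) := Nat.one_le_pow _ _ (by omega)
  rw [pow_succ]
  set x := (ℓ + 1) ^ (K - n)
  set a := (ℓ + 1) ^ a'
  have h1 : 8 * (x * 5) ≤ a * (x * (ℓ + 1)) := Nat.mul_le_mul hM8 (Nat.mul_le_mul_left x (by omega))
  omega

/-- `bigSide ∣ N` at the member (`N = bigSide·(2·L^{m+n−1−a′})`). [cite: Balaban1984PropagatorsII, (2.1) p.224 (dictionary)] -/
theorem bigSide_dvd_sitesPerDir (hℓ : 4 ≤ ℓ) (m n K a' : ℕ) (hk1 : 1 ≤ K - n) (hsize : a' + 3 ≤ m + n) :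
    bigSide ℓ ((ℓ + 1) ^ a') (K - n) ∣ (PV 2 ℓ m K hd3 hL).sitesPerDir 0 := by
  rw [sitesPerDir_memberIdx (hL := hL) hℓ m n K a' hk1 hsize]
  exact dvd_mul_right _ _

/-- **AN ALIGNED CUBE OF SIDE `2·bigSide` IS A CLASS CUBE OF INDEX `K − n`** at the member of record (corner on the big-block grid; every site has level `K − n`).
[cite: Balaban1985BackgroundPropagators, p.396 (the cube class, «O(1) will mean a number ≤ 10»)] -/
theorem gridCube_mem_cubeClass396 (hℓ : 4 ≤ ℓ) (m : ℕ) (hm : 1 ≤ m) (n K a' R : ℕ) (hk1 : 1 ≤ K - n) (hsize : a' + 3 ≤ m + n) (hM8 : 8 ≤ (ℓ + 1) ^ a')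
    (hR2 : 2 * (ℓ + 1) ^ 2 ≤ R) (c : Site (PV 2 ℓ m K hd3 hL) 0) (hc : ∀ μ, bigSide ℓ ((ℓ + 1) ^ a') (K - n) ∣ (c μ).val) :
    (torusCube c (2 * bigSide ℓ ((ℓ + 1) ^ a') (K - n)), K - n) ∈ cubeClass396 (memberIdx ℓ hL hℓ m hm n K a' R hk1 hsize hM8 hR2) := by
  set i := memberIdx ℓ hL hℓ m hm n K a' R hk1 hsize hM8 hR2 with hi
  have hlev : ∀ x, levV1 i x = K - n := levV1_memberIdx hℓ m hm n K a' R hk1 hsize hM8 hR2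
  have h2B := two_mul_side_add_two_le (hL := hL) hℓ m n K a' hk1 hsize (n' := 2) (by norm_num)
  have hpos : 0 < 2 * bigSide ℓ ((ℓ + 1) ^ a') (K - n) := by
    have := bigSide_ge (K := K) (n := n) hℓ hM8; omega
  refine ⟨hk1, ?_, ⟨c, 2, by norm_num, by norm_num, hc, by show 2 * bigSide ℓ ((ℓ + 1) ^ a') (K - n) < (PV 2 ℓ m K hd3 hL).sitesPerDir 0; omega, rfl⟩,
    fun x _ => Or.inl (hlev x), ⟨c, mem_torusCube_self c hpos, hlev c⟩⟩
  have h := levV1_le i c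
  rw [hlev c] at h
  exact h

/-- `ξ = scaleLen L η (K − n) = L^{K−n}·L^{−(K−n)} = 1` at the member. [cite: Balaban1985BackgroundPropagators, (3.35) p.396 (top scale)] -/
theorem scaleLen_eta_memberIdx (hℓ : 4 ≤ ℓ) (m : ℕ) (hm : 1 ≤ m) (n K a' R : ℕ) (hk1 : 1 ≤ K - n) (hsize : a' + 3 ≤ m + n) (hM8 : 8 ≤ (ℓ + 1) ^ a')
    (hR2 : 2 * (ℓ + 1) ^ 2 ≤ R) :
    scaleLen ((ℓ + 1 : ℕ) : ℝ) (kGeo (memberIdx ℓ hL hℓ m hm n K a' R hk1 hsize hM8 hR2)).eta (K - n) = 1 := by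
  rw [scaleLen, eta_memberIdx]
  have : (0 : ℝ) < (((ℓ + 1 : ℕ) : ℝ)) ^ (K - n) := by positivity
  field_simp

/-! ## §2 The frames of `lemmaH_curved_of_rows`, unconditionally at the member -/

/-- ★★★ **THE FRAMES OF `lemmaH_curved_of_rows` FROM `RegPr` ALONE (print's regime `M·α₀ ≤ a₅`)** — see the module docstring.
[cite: Balaban1985RegularSpaces, (1.33) p.82, Prop. 6 p.99; Balaban1985BackgroundPropagators, (3.35) p.396; Balaban1985Variational, Sect. A p.280] -/
theorem exists_frames_T3_of_regPr (hℓ4 : 4 ≤ ℓ) :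
    ∃ c35 a₅ : ℝ, 0 < c35 ∧ 0 < a₅ ∧
      ∀ (hℓ : 4 ≤ ℓ) (m : ℕ) (hm : 1 ≤ m) (n K a' R : ℕ) (hk1 : 1 ≤ K - n) (hsize : a' + 3 ≤ m + n) (hM8 : 8 ≤ (ℓ + 1) ^ a')
        (hR2 : 2 * (ℓ + 1) ^ 2 ≤ R) (α₀ : ℝ), 0 < α₀ → ((ℓ + 1 : ℕ) : ℝ) * (((ℓ + 1) ^ a' : ℕ) : ℝ) * α₀ ≤ a₅ →
        ∀ W : GaugeField (PV 2 ℓ m K hd3 hL) 0 (Matrix.specialUnitaryGroup (Fin 2) ℂ),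
          RegPr (⟨ℓ + 1, hL, m, hm⟩ : T3Family) n K α₀ W →
          ∃ Fr : Site (PV 2 ℓ m K hd3 hL) (K - n) → Site (PV 2 ℓ m K hd3 hL) 0 → (Matrix (Fin 2) (Fin 2) ℂ)ˣ,
            (∀ y z, ‖(Fr y z : Matrix (Fin 2) (Fin 2) ℂ)‖ ≤ 1 ∧ ‖(((Fr y z)⁻¹ : (Matrix (Fin 2) (Fin 2) ℂ)ˣ) : Matrix (Fin 2) (Fin 2) ℂ)‖ ≤ 1) ∧
            (∀ y, Fr y (embIter (K - n) y) = 1) ∧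
            (∀ (y : Site (PV 2 ℓ m K hd3 hL) (K - n)) (z : Site (PV 2 ℓ m K hd3 hL) 0),
              (∀ ν : Fin (PV 2 ℓ m K hd3 hL).d,
                (y ν = (iterBlockOf (K - n) (fun κ => z κ - (((((PV 2 ℓ m K hd3 hL).L ^ (K - n) - 1) / 2 : ℕ)) : ZMod ((PV 2 ℓ m K hd3 hL).sitesPerDir 0)))) ν - 1
                ∨ y ν = (iterBlockOf (K - n) (fun κ => z κ - (((((PV 2 ℓ m K hd3 hL).L ^ (K - n) - 1) / 2 : ℕ)) : ZMod ((PV 2 ℓ m K hd3 hL).sitesPerDir 0)))) ν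
                ∨ y ν = (iterBlockOf (K - n) (fun κ => z κ - (((((PV 2 ℓ m K hd3 hL).L ^ (K - n) - 1) / 2 : ℕ)) : ZMod ((PV 2 ℓ m K hd3 hL).sitesPerDir 0)))) ν + 1
                ∨ y ν = (iterBlockOf (K - n) (fun κ => z κ - (((((PV 2 ℓ m K hd3 hL).L ^ (K - n) - 1) / 2 : ℕ)) : ZMod ((PV 2 ℓ m K hd3 hL).sitesPerDir 0)))) ν + 2)) →
              ∀ μ : Fin (PV 2 ℓ m K hd3 hL).d,
                ‖(((Fr y z)⁻¹ * unitsField (toUField W) ⟨z, μ⟩ * Fr y (torusT (PV 2 ℓ m K hd3 hL) 0 μ z) : (Matrix (Fin 2) (Fin 2) ℂ)ˣ) : Matrix (Fin 2) (Fin 2) ℂ) - 1‖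
                    ≤ (((ℓ + 1 : ℕ) : ℝ) ^ (K - n))⁻¹ * (c35 * (((ℓ + 1 : ℕ) : ℝ) * (((ℓ + 1) ^ a' : ℕ) : ℝ)) * α₀) * Real.exp ((((ℓ + 1 : ℕ) : ℝ) ^ (K - n))⁻¹ * (c35 * (((ℓ + 1 : ℕ) : ℝ) * (((ℓ + 1) ^ a' : ℕ) : ℝ)) * α₀))
                ∧ ‖(((Fr y ((torusT (PV 2 ℓ m K hd3 hL) 0 μ).symm z))⁻¹ * unitsField (toUField W) ⟨(torusT (PV 2 ℓ m K hd3 hL) 0 μ).symm z, μ⟩ * Fr y z :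
                      (Matrix (Fin 2) (Fin 2) ℂ)ˣ) : Matrix (Fin 2) (Fin 2) ℂ) - 1‖
                    ≤ (((ℓ + 1 : ℕ) : ℝ) ^ (K - n))⁻¹ * (c35 * (((ℓ + 1 : ℕ) : ℝ) * (((ℓ + 1) ^ a' : ℕ) : ℝ)) * α₀) * Real.exp ((((ℓ + 1 : ℕ) : ℝ) ^ (K - n))⁻¹ * (c35 * (((ℓ + 1 : ℕ) : ℝ) * (((ℓ + 1) ^ a' : ℕ) : ℝ)) * α₀))
                ∧ ‖(((Fr y z)⁻¹ * unitsField (toUField W) ⟨z, μ⟩ * Fr y (torusT (PV 2 ℓ m K hd3 hL) 0 μ z) : (Matrix (Fin 2) (Fin 2) ℂ)ˣ) : Matrix (Fin 2) (Fin 2) ℂ)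
                    - (((Fr y ((torusT (PV 2 ℓ m K hd3 hL) 0 μ).symm z))⁻¹ * unitsField (toUField W) ⟨(torusT (PV 2 ℓ m K hd3 hL) 0 μ).symm z, μ⟩ * Fr y z :
                      (Matrix (Fin 2) (Fin 2) ℂ)ˣ) : Matrix (Fin 2) (Fin 2) ℂ)‖
                    ≤ (((ℓ + 1 : ℕ) : ℝ) ^ (K - n))⁻¹ * ((((ℓ + 1 : ℕ) : ℝ) ^ (K - n))⁻¹ * (c35 * (((ℓ + 1 : ℕ) : ℝ) * (((ℓ + 1) ^ a' : ℕ) : ℝ)) * α₀)) * Real.exp ((((ℓ + 1 : ℕ) : ℝ) ^ (K - n))⁻¹ * (c35 * (((ℓ + 1 : ℕ) : ℝ) * (((ℓ + 1) ^ a' : ℕ) : ℝ)) * α₀))) := by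
  obtain ⟨c35, a₅, hc35, ha₅, H⟩ := reg335_reg336_T3_of_regPr ℓ hL hℓ4
  refine ⟨c35, a₅, hc35, ha₅, ?_⟩
  intro hℓ m hm n K a' R hk1 hsize hM8 hR2 α₀ hα₀ hMα W hreg
  set i := memberIdx ℓ hL hℓ m hm n K a' R hk1 hsize hM8 hR2 with hi
  -- (3.35) of the reading on the member's cube class
  have h335 := ((reg335_bgT3_iff i c35 α₀ W).1 (H hℓ m hm n K a' R hk1 hsize hM8 hR2 α₀ hα₀ hMα W hreg c35 le_rfl).1)
  -- the cubes: grid size `B := bigSide`, aligned cubes of side `2B`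
  set B := bigSide ℓ ((ℓ + 1) ^ a') (K - n) with hB
  have hkw' : K - n ≤ (PV 2 ℓ m K hd3 hL).m + (PV 2 ℓ m K hd3 hL).K := hkw ℓ hL m n K
  have hBge : 4 * (PV 2 ℓ m K hd3 hL).L ^ (K - n) + 1 ≤ B := bigSide_ge (K := K) (n := n) hℓ hM8
  have hBN : B ∣ (PV 2 ℓ m K hd3 hL).sitesPerDir 0 := bigSide_dvd_sitesPerDir (hL := hL) hℓ m n K a' hk1 hsize
  have h2B : 2 * (2 * B) + 2 ≤ (PV 2 ℓ m K hd3 hL).sitesPerDir 0 := two_mul_side_add_two_le (hL := hL) hℓ m n K a' hk1 hsize (n' := 2) (by norm_num)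
  have hη : 0 < (kGeo i).eta := (eta_pos_L_one_le_M_pos i).1
  -- per-centre class cube carrying `Reg335Cube`
  have hReg : ∀ y : Site (PV 2 ℓ m K hd3 hL) (K - n), ∃ cube : Set (Site (PV 2 ℓ m K hd3 hL) 0),
      (∀ z : Site (PV 2 ℓ m K hd3 hL) 0, (∀ ν : Fin (PV 2 ℓ m K hd3 hL).d,
          (y ν = (iterBlockOf (K - n) (fun κ => z κ - (((((PV 2 ℓ m K hd3 hL).L ^ (K - n) - 1) / 2 : ℕ)) : ZMod ((PV 2 ℓ m K hd3 hL).sitesPerDir 0)))) ν - 1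
          ∨ y ν = (iterBlockOf (K - n) (fun κ => z κ - (((((PV 2 ℓ m K hd3 hL).L ^ (K - n) - 1) / 2 : ℕ)) : ZMod ((PV 2 ℓ m K hd3 hL).sitesPerDir 0)))) ν
          ∨ y ν = (iterBlockOf (K - n) (fun κ => z κ - (((((PV 2 ℓ m K hd3 hL).L ^ (K - n) - 1) / 2 : ℕ)) : ZMod ((PV 2 ℓ m K hd3 hL).sitesPerDir 0)))) ν + 1
          ∨ y ν = (iterBlockOf (K - n) (fun κ => z κ - (((((PV 2 ℓ m K hd3 hL).L ^ (K - n) - 1) / 2 : ℕ)) : ZMod ((PV 2 ℓ m K hd3 hL).sitesPerDir 0)))) ν + 2)) →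
        z ∈ cube ∧ ∀ μ : Fin (PV 2 ℓ m K hd3 hL).d, torusT (PV 2 ℓ m K hd3 hL) 0 μ z ∈ cube ∧ (torusT (PV 2 ℓ m K hd3 hL) 0 μ).symm z ∈ cube) ∧
      Reg335Cube (torusT (PV 2 ℓ m K hd3 hL) 0) (fun κ z => unitsField (toUField W) ⟨z, κ⟩) (kGeo i).eta cube
        (scaleLen ((ℓ + 1 : ℕ) : ℝ) (kGeo i).eta (K - n)) (c35 * (kGeo i).M * α₀) := by
    intro y
    obtain ⟨c, hc, hcov⟩ := exists_gridCube_cover hkw' B hBge hBN h2B y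
    have hq := gridCube_mem_cubeClass396 (hL := hL) hℓ m hm n K a' R hk1 hsize hM8 hR2 c hc
    exact ⟨torusCube c (2 * B), hcov, h335 _ hq⟩
  obtain ⟨Fr, hFr, hFr1, hA⟩ := exists_frames_of_reg335_T3 (⟨ℓ + 1, hL, m, hm⟩ : T3Family) K n hkw' W hη hReg
  refine ⟨Fr, hFr, hFr1, ?_⟩
  -- the constants: `ξ = 1`, `η = L^{−(K−n)}`, `M = L·L^{a′}`
  have hξ : scaleLen ((ℓ + 1 : ℕ) : ℝ) (kGeo i).eta (K - n) = 1 := scaleLen_eta_memberIdx (hL := hL) hℓ m hm n K a' R hk1 hsize hM8 hR2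
  have hηe : (kGeo i).eta = ((((ℓ + 1 : ℕ) : ℝ)) ^ (K - n))⁻¹ := eta_memberIdx hℓ m hm n K a' R hk1 hsize hM8 hR2
  have hMe : (kGeo i).M = ((ℓ + 1 : ℕ) : ℝ) * (((ℓ + 1) ^ a' : ℕ) : ℝ) := M_memberIdx hℓ m hm n K a' R hk1 hsize hM8 hR2
  rw [hξ, inv_one, mul_one, one_pow, inv_one, mul_one, hηe, hMe] at hA
  intro y z hz μ
  exact hA y z hz μ

end Summit.QuantumFields.YangMills.Theorems.Prop7LemmaHCurvedFramesOfRegPr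

end
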